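import Summits.QuantumFields.YangMills.Theorems.PoincareLipschitzSU2SphereDictionary
import Summits.QuantumFields.YangMills.Theorems.PoincareLipschitzOrbitMinimiserLevel

/-!
# Crux `HistoryTailL` (stmt-QuantumFields-19936), K2 organ of record «LOC-REG-MIN» (`hReg`, route crux `PoincareLipschitz.BlockLipschitzL`, stmt-QuantumFields-23533):
# THE TWISTED ONE-SITE EULER–LAGRANGE EQUATION OF A BOX-ℓ²-ORBIT MINIMISER IN `S³` LETTERS — `|N_x|·v(h_x) = N_x`,
# the discrete harmonic-map equation (I1) of the regularity files, for the twisted lattice map `u = v ∘ h`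

Cell `ym3-torus` (YM ladder rung R3 = continuum SU(2) Yang–Mills on the three-torus — a RUNG, NOT the Clay problem: not d = 4, not infinite
volume, not a mass gap), LEAD seat `ym-ust-19936-w1` gen 8; `--supports stmt-QuantumFields-19936 --as helper`; THEOREMS ONLY, definition-free; imports
✓p697253 `…SU2SphereDictionary` + ✓`…PoincareLipschitzOrbitMinimiserLevel` (★w5-19936 g10's one-site competitor).

WHY.  The K2 face of record `hReg` (✓p697363 `blockLipschitzL_of_orbitMinRegularity`) is an ε-regularity statement for box-ℓ²-orbit MINIMISERS `h` of
`Σ_b dist1(V_b·(h·W)_b⁻¹)²`.  Its STABILITY half is typed as letters (✓p695660, ✓p696746, ✓p696762, ✓p697253 + the box cutoff ∕ transfer in flight); its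
REGULARITY half (px7 g5's small-range files ✓p697057 …, ★w5 g12's E→R road) is written for ONE-SITE-OPTIMAL sphere-valued lattice maps: `‖N_x‖·u_x = N_x`,
`N_x` = the sum of the neighbouring values.  THIS FILE derives that equation, TWISTED, at the orbit minimiser, in the `Fin 4 → ℝ` letters of the dictionary:
with `v(U) = (Re U₀₀, Im U₀₀, Re U₁₀, Im U₁₀)` and the TWISTED NEIGHBOUR SUM
`N_x := Σ_{b ∈ box, b₋ = x} v(V_b·h(b₊)·W_b⁻¹) + Σ_{b ∈ box, b₊ = x} v(V_b⁻¹·h(b₋)·W_b)`,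
the one-site competitor inequality ✓`reTr_oneSite_le_of_orbitMin_level` reads `v(g)·N_x ≤ v(h_x)·N_x` for EVERY `g ∈ SU(2)` (`reTr(P·Q⁻¹) = v(P)·v(Q)`), i.e.
`p·N_x ≤ v(h_x)·N_x` for every unit `p ∈ ℝ⁴` (✓`exists_su2_coords_eq`), hence (the linear functional `p ↦ p·N` on the sphere is maximal at `v(h_x)`)
`√(N_x·N_x)·v(h_x) = N_x` — px7's (I1) for `u = v ∘ h` with the bond transports `g ↦ V_b g W_b⁻¹` (`b₋ = x`) and `g ↦ V_b⁻¹ g W_b` (`b₊ = x`).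

* §1 `dot_coords_inv_inv` (`v(P⁻¹)·v(Q⁻¹) = v(P)·v(Q)`), ★ `reTr_mul_inv_eq_dot` (`reTr(P·Q⁻¹) = v(P)·v(Q)`), `dot_sum_ite` (dot product against an `if`-sum).
* §2 ★ `sqrt_dot_smul_eq_of_forall_dot_le` (sphere maximiser ⇒ `√(N·N)·u = N`, no Cauchy–Schwarz: test `p = N/|N|`, expand `|N − |N|u|²`).
* §3 ★★ `dot_twistedNbr_le_of_orbitMin` (`∀ g, v(g)·N_x ≤ v(h_x)·N_x`), ★★ `unit_dot_twistedNbr_le_of_orbitMin` (`∀` unit `p`), ★★★ `oneSite_euler_lagrange`.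
HONEST SCOPE.  The Euler–Lagrange (one-site) condition only; nothing of `hReg`, its regularity half, `BlockLipschitzL`, `HistoryTailL` or any summit statement is proved.
YM₃ on T³ is rung R3, NOT the Clay problem.

References: T. Bałaban, Commun. Math. Phys. **109** (1987) 249–301 [Balaban1987RG1] ((0.14) p.254); M. Giaquinta, *Multiple integrals in the calculus of variations*,
Ann. Math. Stud. 105 (1983) [Giaquinta1984] (Ch. VI, harmonic maps into spheres: the equation `−Δu = |∇u|²u`).
-/

set_option autoImplicit false

noncomputable section

open scoped BigOperators ComplexConjugate Matrix.Norms.L2Operator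
open Matrix

namespace Summit.QuantumFields.YangMills.Theorems.PoincareLipschitzOrbitMinOneSiteSphere

open Literature.MathematicalPhysics.QuantumFieldTheory.Balaban1983to89
open Summit.QuantumFields.YangMills.Theorems.PoincareLipschitzSU2SphereDictionary
  (reTr_inv_mul_eq_dot coords_dot_self exists_su2_coords_eq)
open Summit.QuantumFields.YangMills.Theorems.PoincareLipschitzOrbitMinLevel (reTr_oneSite_le_of_orbitMin_level)

/-! ## §1 Letters -/

/-- `v(P⁻¹)·v(Q⁻¹) = v(P)·v(Q)` (`reTr(PQ⁻¹) = reTr(P⁻¹Q)` by `reTr g⁻¹ = reTr g` and conjugation invariance). [cite: Balaban1987RG1, (0.2) p.252] -/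
theorem dot_coords_inv_inv (P Q : Matrix.specialUnitaryGroup (Fin 2) ℂ) :
    dotProduct ![(((P⁻¹ : Matrix.specialUnitaryGroup (Fin 2) ℂ) : Matrix (Fin 2) (Fin 2) ℂ) 0 0).re,
        (((P⁻¹ : Matrix.specialUnitaryGroup (Fin 2) ℂ) : Matrix (Fin 2) (Fin 2) ℂ) 0 0).im,
        (((P⁻¹ : Matrix.specialUnitaryGroup (Fin 2) ℂ) : Matrix (Fin 2) (Fin 2) ℂ) 1 0).re,
        (((P⁻¹ : Matrix.specialUnitaryGroup (Fin 2) ℂ) : Matrix (Fin 2) (Fin 2) ℂ) 1 0).im]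
      ![(((Q⁻¹ : Matrix.specialUnitaryGroup (Fin 2) ℂ) : Matrix (Fin 2) (Fin 2) ℂ) 0 0).re,
        (((Q⁻¹ : Matrix.specialUnitaryGroup (Fin 2) ℂ) : Matrix (Fin 2) (Fin 2) ℂ) 0 0).im,
        (((Q⁻¹ : Matrix.specialUnitaryGroup (Fin 2) ℂ) : Matrix (Fin 2) (Fin 2) ℂ) 1 0).re,
        (((Q⁻¹ : Matrix.specialUnitaryGroup (Fin 2) ℂ) : Matrix (Fin 2) (Fin 2) ℂ) 1 0).im] =
      dotProduct ![((P : Matrix (Fin 2) (Fin 2) ℂ) 0 0).re, ((P : Matrix (Fin 2) (Fin 2) ℂ) 0 0).im,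
        ((P : Matrix (Fin 2) (Fin 2) ℂ) 1 0).re, ((P : Matrix (Fin 2) (Fin 2) ℂ) 1 0).im]
      ![((Q : Matrix (Fin 2) (Fin 2) ℂ) 0 0).re, ((Q : Matrix (Fin 2) (Fin 2) ℂ) 0 0).im,
        ((Q : Matrix (Fin 2) (Fin 2) ℂ) 1 0).re, ((Q : Matrix (Fin 2) (Fin 2) ℂ) 1 0).im] := by
  rw [← reTr_inv_mul_eq_dot, ← reTr_inv_mul_eq_dot, inv_inv]
  -- `reTr(P Q⁻¹) = reTr(P⁻¹ Q)`
  rw [← GaugeGroup.reTr_inv (P * Q⁻¹)]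
  have h : (P * Q⁻¹)⁻¹ = Q * (P⁻¹ * Q) * Q⁻¹ := by group
  rw [h, GaugeGroup.reTr_conj]

/-- ★ **`reTr(P·Q⁻¹) = v(P)·v(Q)`** for `P, Q ∈ SU(2)`. [cite: Balaban1987RG1, (0.14) p.254] -/
theorem reTr_mul_inv_eq_dot (P Q : Matrix.specialUnitaryGroup (Fin 2) ℂ) :
    GaugeGroup.reTr (P * Q⁻¹) =
      dotProduct ![((P : Matrix (Fin 2) (Fin 2) ℂ) 0 0).re, ((P : Matrix (Fin 2) (Fin 2) ℂ) 0 0).im,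
          ((P : Matrix (Fin 2) (Fin 2) ℂ) 1 0).re, ((P : Matrix (Fin 2) (Fin 2) ℂ) 1 0).im]
        ![((Q : Matrix (Fin 2) (Fin 2) ℂ) 0 0).re, ((Q : Matrix (Fin 2) (Fin 2) ℂ) 0 0).im,
          ((Q : Matrix (Fin 2) (Fin 2) ℂ) 1 0).re, ((Q : Matrix (Fin 2) (Fin 2) ℂ) 1 0).im] := by
  rw [← dot_coords_inv_inv, ← reTr_inv_mul_eq_dot, inv_inv]

/-- A dot product against an `if`-sum: `p · Σ_b (if c_b then w_b else 0) = Σ_b (if c_b then p·w_b else 0)`. [folklore] -/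
theorem dot_sum_ite {ι : Type*} (s : Finset ι) (c : ι → Prop) [DecidablePred c] (p : Fin 4 → ℝ) (w : ι → Fin 4 → ℝ) :
    dotProduct p (∑ b ∈ s, if c b then w b else 0) = ∑ b ∈ s, if c b then dotProduct p (w b) else 0 := by
  have h : dotProduct p (∑ b ∈ s, if c b then w b else 0) = ∑ b ∈ s, dotProduct p (if c b then w b else 0) := by
    unfold dotProduct
    rw [Finset.sum_comm]
    refine Finset.sum_congr rfl fun i _ => ?_
    rw [Finset.sum_apply, Finset.mul_sum]
  rw [h]
  refine Finset.sum_congr rfl fun b _ => ?_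
  split_ifs
  · rfl
  · exact dotProduct_zero p

/-! ## §2 The sphere maximiser -/

/-- ★ **A LINEAR FUNCTIONAL ON THE SPHERE IS MAXIMAL ONLY AT ITS OWN DIRECTION**: if `u` is a unit vector and `p·N ≤ u·N` for every unit `p`, then
`√(N·N)·u = N` (test `p = N/√(N·N)` and expand `|N − √(N·N)u|² = 2(N·N) − 2√(N·N)(u·N) ≤ 0`; the case `N = 0` is trivial). [folklore] -/
theorem sqrt_dot_smul_eq_of_forall_dot_le (u N : Fin 4 → ℝ) (hu : dotProduct u u = 1)
    (hmax : ∀ p : Fin 4 → ℝ, dotProduct p p = 1 → dotProduct p N ≤ dotProduct u N) :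
    Real.sqrt (dotProduct N N) • u = N := by
  have hnn : ∀ z : Fin 4 → ℝ, 0 ≤ dotProduct z z := fun z => by
    show 0 ≤ ∑ i, z i * z i
    exact Finset.sum_nonneg fun i _ => mul_self_nonneg (z i)
  set m : ℝ := Real.sqrt (dotProduct N N) with hm
  have hm0 : 0 ≤ m := Real.sqrt_nonneg _
  have hm2 : m * m = dotProduct N N := Real.mul_self_sqrt (hnn N)
  by_cases hN : dotProduct N N = 0
  · -- `N = 0`
    have hN0 : N = 0 := by
      funext i
      have h := Finset.sum_eq_zero_iff_of_nonneg (fun j _ => mul_self_nonneg (N j)) |>.mp hN i (Finset.mem_univ i)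
      exact mul_self_eq_zero.mp h
    rw [hm, hN, Real.sqrt_zero, zero_smul]
    exact hN0.symm
  · have hmpos : 0 < m := by
      rcases lt_or_eq_of_le hm0 with h | h
      · exact h
      · exfalso; apply hN; rw [← hm2, ← h, mul_zero]
    -- test the unit vector `p = N / m`
    have hp : dotProduct (m⁻¹ • N) (m⁻¹ • N) = 1 := by
      rw [smul_dotProduct, dotProduct_smul, smul_eq_mul, smul_eq_mul, ← hm2]
      field_simp
    have hle := hmax (m⁻¹ • N) hp
    rw [smul_dotProduct, smul_eq_mul, ← hm2] at hle
    have hle' : m ≤ dotProduct u N := by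
      have : m⁻¹ * (m * m) = m := by field_simp
      linarith [this ▸ hle]
    -- expand `|N − m u|²`
    have hsq : dotProduct (N - m • u) (N - m • u) = 2 * (m * m) - 2 * m * dotProduct u N := by
      rw [sub_dotProduct, dotProduct_sub, dotProduct_sub, smul_dotProduct, dotProduct_smul, dotProduct_smul, smul_dotProduct, hu,
        dotProduct_comm N u, ← hm2]
      simp only [smul_eq_mul]
      ring
    have hle0 : dotProduct (N - m • u) (N - m • u) ≤ 0 := by rw [hsq]; nlinarith
    have hzero : dotProduct (N - m • u) (N - m • u) = 0 := le_antisymm hle0 (hnn _)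
    have hNmu : N - m • u = 0 := by
      funext i
      have h := Finset.sum_eq_zero_iff_of_nonneg (fun j _ => mul_self_nonneg ((N - m • u) j)) |>.mp hzero i (Finset.mem_univ i)
      exact mul_self_eq_zero.mp h
    rw [sub_eq_zero] at hNmu
    exact hNmu.symm

/-! ## §3 The twisted one-site Euler–Lagrange equation at a box-ℓ²-orbit minimiser -/

section EL

variable {P : Params} {i : ℕ}

/-- ★★ **ONE-SITE OPTIMALITY IN `S³` LETTERS**: at a level-`i` box-ℓ²-orbit minimiser `h·W` (✓`reTr_oneSite_le_of_orbitMin_level`'s hypothesis, for `V' := h·W`),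
for every site `x` and EVERY `g ∈ SU(2)`: `v(g)·N_x ≤ v(h_x)·N_x`, where `N_x` is the twisted neighbour sum
`Σ_{b∈box, b₋=x} v(V_b·h(b₊)·W_b⁻¹) + Σ_{b∈box, b₊=x} v(V_b⁻¹·h(b₋)·W_b)`.  (`reTr((g h_x⁻¹)·(V'_bV_b⁻¹)) = v(g)·v(V_b h(b₊) W_b⁻¹)` etc., by
`reTr(PQ⁻¹) = v(P)·v(Q)`.) [cite: Balaban1987RG1, (0.14) p.254] -/
theorem dot_twistedNbr_le_of_orbitMin (box : PBond P i → Prop) [DecidablePred box]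
    (V W : GaugeField P i (Matrix.specialUnitaryGroup (Fin 2) ℂ)) (h : GaugeTransf P i (Matrix.specialUnitaryGroup (Fin 2) ℂ))
    (hmin : ∀ k : GaugeTransf P i (Matrix.specialUnitaryGroup (Fin 2) ℂ),
      (∑ b : PBond P i, if box b then dist1 (V b * (GaugeField.gaugeAct h W b)⁻¹) ^ 2 else 0) ≤
        ∑ b : PBond P i, if box b then dist1 (V b * (GaugeField.gaugeAct k (GaugeField.gaugeAct h W) b)⁻¹) ^ 2 else 0)
    (x : Site P i) (g : Matrix.specialUnitaryGroup (Fin 2) ℂ) :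
    dotProduct ![((g : Matrix (Fin 2) (Fin 2) ℂ) 0 0).re, ((g : Matrix (Fin 2) (Fin 2) ℂ) 0 0).im,
        ((g : Matrix (Fin 2) (Fin 2) ℂ) 1 0).re, ((g : Matrix (Fin 2) (Fin 2) ℂ) 1 0).im]
      ((∑ b : PBond P i, if box b ∧ b.src = x then
          ![(((V b * h b.tgt * (W b)⁻¹ : Matrix.specialUnitaryGroup (Fin 2) ℂ) : Matrix (Fin 2) (Fin 2) ℂ) 0 0).re,
            (((V b * h b.tgt * (W b)⁻¹ : Matrix.specialUnitaryGroup (Fin 2) ℂ) : Matrix (Fin 2) (Fin 2) ℂ) 0 0).im,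
            (((V b * h b.tgt * (W b)⁻¹ : Matrix.specialUnitaryGroup (Fin 2) ℂ) : Matrix (Fin 2) (Fin 2) ℂ) 1 0).re,
            (((V b * h b.tgt * (W b)⁻¹ : Matrix.specialUnitaryGroup (Fin 2) ℂ) : Matrix (Fin 2) (Fin 2) ℂ) 1 0).im] else 0) +
        ∑ b : PBond P i, if box b ∧ b.tgt = x then
          ![((((V b)⁻¹ * h b.src * W b : Matrix.specialUnitaryGroup (Fin 2) ℂ) : Matrix (Fin 2) (Fin 2) ℂ) 0 0).re,
            ((((V b)⁻¹ * h b.src * W b : Matrix.specialUnitaryGroup (Fin 2) ℂ) : Matrix (Fin 2) (Fin 2) ℂ) 0 0).im,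
            ((((V b)⁻¹ * h b.src * W b : Matrix.specialUnitaryGroup (Fin 2) ℂ) : Matrix (Fin 2) (Fin 2) ℂ) 1 0).re,
            ((((V b)⁻¹ * h b.src * W b : Matrix.specialUnitaryGroup (Fin 2) ℂ) : Matrix (Fin 2) (Fin 2) ℂ) 1 0).im] else 0) ≤
    dotProduct ![(((h x : Matrix.specialUnitaryGroup (Fin 2) ℂ) : Matrix (Fin 2) (Fin 2) ℂ) 0 0).re,
        (((h x : Matrix.specialUnitaryGroup (Fin 2) ℂ) : Matrix (Fin 2) (Fin 2) ℂ) 0 0).im,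
        (((h x : Matrix.specialUnitaryGroup (Fin 2) ℂ) : Matrix (Fin 2) (Fin 2) ℂ) 1 0).re,
        (((h x : Matrix.specialUnitaryGroup (Fin 2) ℂ) : Matrix (Fin 2) (Fin 2) ℂ) 1 0).im]
      ((∑ b : PBond P i, if box b ∧ b.src = x then
          ![(((V b * h b.tgt * (W b)⁻¹ : Matrix.specialUnitaryGroup (Fin 2) ℂ) : Matrix (Fin 2) (Fin 2) ℂ) 0 0).re,
            (((V b * h b.tgt * (W b)⁻¹ : Matrix.specialUnitaryGroup (Fin 2) ℂ) : Matrix (Fin 2) (Fin 2) ℂ) 0 0).im,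
            (((V b * h b.tgt * (W b)⁻¹ : Matrix.specialUnitaryGroup (Fin 2) ℂ) : Matrix (Fin 2) (Fin 2) ℂ) 1 0).re,
            (((V b * h b.tgt * (W b)⁻¹ : Matrix.specialUnitaryGroup (Fin 2) ℂ) : Matrix (Fin 2) (Fin 2) ℂ) 1 0).im] else 0) +
        ∑ b : PBond P i, if box b ∧ b.tgt = x then
          ![((((V b)⁻¹ * h b.src * W b : Matrix.specialUnitaryGroup (Fin 2) ℂ) : Matrix (Fin 2) (Fin 2) ℂ) 0 0).re,
            ((((V b)⁻¹ * h b.src * W b : Matrix.specialUnitaryGroup (Fin 2) ℂ) : Matrix (Fin 2) (Fin 2) ℂ) 0 0).im,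
            ((((V b)⁻¹ * h b.src * W b : Matrix.specialUnitaryGroup (Fin 2) ℂ) : Matrix (Fin 2) (Fin 2) ℂ) 1 0).re,
            ((((V b)⁻¹ * h b.src * W b : Matrix.specialUnitaryGroup (Fin 2) ℂ) : Matrix (Fin 2) (Fin 2) ℂ) 1 0).im] else 0) := by
  -- the one-site competitor inequality of the tree, at `g h_x⁻¹`
  have key := reTr_oneSite_le_of_orbitMin_level box V (GaugeField.gaugeAct h W) hmin x (g * (h x)⁻¹)
  -- translate each term: source bonds
  have hsrc : ∀ (g' : Matrix.specialUnitaryGroup (Fin 2) ℂ) (b : PBond P i), b.src = x →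
      GaugeGroup.reTr ((g' * (h x)⁻¹) * (GaugeField.gaugeAct h W b * (V b)⁻¹)) =
        dotProduct ![((g' : Matrix (Fin 2) (Fin 2) ℂ) 0 0).re, ((g' : Matrix (Fin 2) (Fin 2) ℂ) 0 0).im,
            ((g' : Matrix (Fin 2) (Fin 2) ℂ) 1 0).re, ((g' : Matrix (Fin 2) (Fin 2) ℂ) 1 0).im]
          ![(((V b * h b.tgt * (W b)⁻¹ : Matrix.specialUnitaryGroup (Fin 2) ℂ) : Matrix (Fin 2) (Fin 2) ℂ) 0 0).re,
            (((V b * h b.tgt * (W b)⁻¹ : Matrix.specialUnitaryGroup (Fin 2) ℂ) : Matrix (Fin 2) (Fin 2) ℂ) 0 0).im,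
            (((V b * h b.tgt * (W b)⁻¹ : Matrix.specialUnitaryGroup (Fin 2) ℂ) : Matrix (Fin 2) (Fin 2) ℂ) 1 0).re,
            (((V b * h b.tgt * (W b)⁻¹ : Matrix.specialUnitaryGroup (Fin 2) ℂ) : Matrix (Fin 2) (Fin 2) ℂ) 1 0).im] := by
    intro g' b hb
    have hga : GaugeField.gaugeAct h W b = h b.src * W b * (h b.tgt)⁻¹ := rfl
    have hprod : (g' * (h x)⁻¹) * (GaugeField.gaugeAct h W b * (V b)⁻¹) = g' * (V b * h b.tgt * (W b)⁻¹)⁻¹ := by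
      rw [hga, hb]; group
    rw [hprod, reTr_mul_inv_eq_dot]
  -- target bonds
  have htgt : ∀ (g' : Matrix.specialUnitaryGroup (Fin 2) ℂ) (b : PBond P i), b.tgt = x →
      GaugeGroup.reTr ((g' * (h x)⁻¹) * ((GaugeField.gaugeAct h W b)⁻¹ * V b)) =
        dotProduct ![((g' : Matrix (Fin 2) (Fin 2) ℂ) 0 0).re, ((g' : Matrix (Fin 2) (Fin 2) ℂ) 0 0).im,
            ((g' : Matrix (Fin 2) (Fin 2) ℂ) 1 0).re, ((g' : Matrix (Fin 2) (Fin 2) ℂ) 1 0).im]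
          ![((((V b)⁻¹ * h b.src * W b : Matrix.specialUnitaryGroup (Fin 2) ℂ) : Matrix (Fin 2) (Fin 2) ℂ) 0 0).re,
            ((((V b)⁻¹ * h b.src * W b : Matrix.specialUnitaryGroup (Fin 2) ℂ) : Matrix (Fin 2) (Fin 2) ℂ) 0 0).im,
            ((((V b)⁻¹ * h b.src * W b : Matrix.specialUnitaryGroup (Fin 2) ℂ) : Matrix (Fin 2) (Fin 2) ℂ) 1 0).re,
            ((((V b)⁻¹ * h b.src * W b : Matrix.specialUnitaryGroup (Fin 2) ℂ) : Matrix (Fin 2) (Fin 2) ℂ) 1 0).im] := by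
    intro g' b hb
    have hga : GaugeField.gaugeAct h W b = h b.src * W b * (h b.tgt)⁻¹ := rfl
    have hprod : (g' * (h x)⁻¹) * ((GaugeField.gaugeAct h W b)⁻¹ * V b) = g' * ((V b)⁻¹ * h b.src * W b)⁻¹ := by
      rw [hga, hb]; group
    rw [hprod, reTr_mul_inv_eq_dot]
  -- rewrite the four sums of `key`
  have hL1 : (∑ b : PBond P i, if box b ∧ b.src = x then GaugeGroup.reTr ((g * (h x)⁻¹) * (GaugeField.gaugeAct h W b * (V b)⁻¹)) else 0) =
      ∑ b : PBond P i, if box b ∧ b.src = x then dotProduct ![((g : Matrix (Fin 2) (Fin 2) ℂ) 0 0).re, ((g : Matrix (Fin 2) (Fin 2) ℂ) 0 0).im,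
            ((g : Matrix (Fin 2) (Fin 2) ℂ) 1 0).re, ((g : Matrix (Fin 2) (Fin 2) ℂ) 1 0).im]
          ![(((V b * h b.tgt * (W b)⁻¹ : Matrix.specialUnitaryGroup (Fin 2) ℂ) : Matrix (Fin 2) (Fin 2) ℂ) 0 0).re,
            (((V b * h b.tgt * (W b)⁻¹ : Matrix.specialUnitaryGroup (Fin 2) ℂ) : Matrix (Fin 2) (Fin 2) ℂ) 0 0).im,
            (((V b * h b.tgt * (W b)⁻¹ : Matrix.specialUnitaryGroup (Fin 2) ℂ) : Matrix (Fin 2) (Fin 2) ℂ) 1 0).re,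
            (((V b * h b.tgt * (W b)⁻¹ : Matrix.specialUnitaryGroup (Fin 2) ℂ) : Matrix (Fin 2) (Fin 2) ℂ) 1 0).im] else 0 := by
    refine Finset.sum_congr rfl fun b _ => ?_
    split_ifs with hc
    · exact hsrc g b hc.2
    · rfl
  have hL2 : (∑ b : PBond P i, if box b ∧ b.tgt = x then GaugeGroup.reTr ((g * (h x)⁻¹) * ((GaugeField.gaugeAct h W b)⁻¹ * V b)) else 0) =
      ∑ b : PBond P i, if box b ∧ b.tgt = x then dotProduct ![((g : Matrix (Fin 2) (Fin 2) ℂ) 0 0).re, ((g : Matrix (Fin 2) (Fin 2) ℂ) 0 0).im,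
            ((g : Matrix (Fin 2) (Fin 2) ℂ) 1 0).re, ((g : Matrix (Fin 2) (Fin 2) ℂ) 1 0).im]
          ![((((V b)⁻¹ * h b.src * W b : Matrix.specialUnitaryGroup (Fin 2) ℂ) : Matrix (Fin 2) (Fin 2) ℂ) 0 0).re,
            ((((V b)⁻¹ * h b.src * W b : Matrix.specialUnitaryGroup (Fin 2) ℂ) : Matrix (Fin 2) (Fin 2) ℂ) 0 0).im,
            ((((V b)⁻¹ * h b.src * W b : Matrix.specialUnitaryGroup (Fin 2) ℂ) : Matrix (Fin 2) (Fin 2) ℂ) 1 0).re,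
            ((((V b)⁻¹ * h b.src * W b : Matrix.specialUnitaryGroup (Fin 2) ℂ) : Matrix (Fin 2) (Fin 2) ℂ) 1 0).im] else 0 := by
    refine Finset.sum_congr rfl fun b _ => ?_
    split_ifs with hc
    · exact htgt g b hc.2
    · rfl
  -- the right side of `key` is the same at `g := h x` (`h x · (h x)⁻¹ = 1`)
  have hR1 : (∑ b : PBond P i, if box b ∧ b.src = x then GaugeGroup.reTr (GaugeField.gaugeAct h W b * (V b)⁻¹) else 0) =
      ∑ b : PBond P i, if box b ∧ b.src = x then dotProduct
          ![(((h x : Matrix.specialUnitaryGroup (Fin 2) ℂ) : Matrix (Fin 2) (Fin 2) ℂ) 0 0).re,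
            (((h x : Matrix.specialUnitaryGroup (Fin 2) ℂ) : Matrix (Fin 2) (Fin 2) ℂ) 0 0).im,
            (((h x : Matrix.specialUnitaryGroup (Fin 2) ℂ) : Matrix (Fin 2) (Fin 2) ℂ) 1 0).re,
            (((h x : Matrix.specialUnitaryGroup (Fin 2) ℂ) : Matrix (Fin 2) (Fin 2) ℂ) 1 0).im]
          ![(((V b * h b.tgt * (W b)⁻¹ : Matrix.specialUnitaryGroup (Fin 2) ℂ) : Matrix (Fin 2) (Fin 2) ℂ) 0 0).re,
            (((V b * h b.tgt * (W b)⁻¹ : Matrix.specialUnitaryGroup (Fin 2) ℂ) : Matrix (Fin 2) (Fin 2) ℂ) 0 0).im,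
            (((V b * h b.tgt * (W b)⁻¹ : Matrix.specialUnitaryGroup (Fin 2) ℂ) : Matrix (Fin 2) (Fin 2) ℂ) 1 0).re,
            (((V b * h b.tgt * (W b)⁻¹ : Matrix.specialUnitaryGroup (Fin 2) ℂ) : Matrix (Fin 2) (Fin 2) ℂ) 1 0).im] else 0 := by
    refine Finset.sum_congr rfl fun b _ => ?_
    split_ifs with hc
    · rw [← hsrc (h x) b hc.2, mul_inv_cancel, one_mul]
    · rfl
  have hR2 : (∑ b : PBond P i, if box b ∧ b.tgt = x then GaugeGroup.reTr ((GaugeField.gaugeAct h W b)⁻¹ * V b) else 0) =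
      ∑ b : PBond P i, if box b ∧ b.tgt = x then dotProduct
          ![(((h x : Matrix.specialUnitaryGroup (Fin 2) ℂ) : Matrix (Fin 2) (Fin 2) ℂ) 0 0).re,
            (((h x : Matrix.specialUnitaryGroup (Fin 2) ℂ) : Matrix (Fin 2) (Fin 2) ℂ) 0 0).im,
            (((h x : Matrix.specialUnitaryGroup (Fin 2) ℂ) : Matrix (Fin 2) (Fin 2) ℂ) 1 0).re,
            (((h x : Matrix.specialUnitaryGroup (Fin 2) ℂ) : Matrix (Fin 2) (Fin 2) ℂ) 1 0).im]
          ![((((V b)⁻¹ * h b.src * W b : Matrix.specialUnitaryGroup (Fin 2) ℂ) : Matrix (Fin 2) (Fin 2) ℂ) 0 0).re,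
            ((((V b)⁻¹ * h b.src * W b : Matrix.specialUnitaryGroup (Fin 2) ℂ) : Matrix (Fin 2) (Fin 2) ℂ) 0 0).im,
            ((((V b)⁻¹ * h b.src * W b : Matrix.specialUnitaryGroup (Fin 2) ℂ) : Matrix (Fin 2) (Fin 2) ℂ) 1 0).re,
            ((((V b)⁻¹ * h b.src * W b : Matrix.specialUnitaryGroup (Fin 2) ℂ) : Matrix (Fin 2) (Fin 2) ℂ) 1 0).im] else 0 := by
    refine Finset.sum_congr rfl fun b _ => ?_
    split_ifs with hc
    · rw [← htgt (h x) b hc.2, mul_inv_cancel, one_mul]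
    · rfl
  rw [hL1, hL2, hR1, hR2] at key
  rw [dotProduct_add, dotProduct_add, dot_sum_ite, dot_sum_ite, dot_sum_ite, dot_sum_ite]
  exact key



/-- ★★ **THE SAME FOR EVERY UNIT VECTOR**: `p·N_x ≤ v(h_x)·N_x` for all `p ∈ S³ ⊂ ℝ⁴` (every unit vector is `v(g)`, ✓`exists_su2_coords_eq`).
[cite: Balaban1987RG1, (0.14) p.254] -/
theorem unit_dot_twistedNbr_le_of_orbitMin (box : PBond P i → Prop) [DecidablePred box]
    (V W : GaugeField P i (Matrix.specialUnitaryGroup (Fin 2) ℂ)) (h : GaugeTransf P i (Matrix.specialUnitaryGroup (Fin 2) ℂ))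
    (hmin : ∀ k : GaugeTransf P i (Matrix.specialUnitaryGroup (Fin 2) ℂ),
      (∑ b : PBond P i, if box b then dist1 (V b * (GaugeField.gaugeAct h W b)⁻¹) ^ 2 else 0) ≤
        ∑ b : PBond P i, if box b then dist1 (V b * (GaugeField.gaugeAct k (GaugeField.gaugeAct h W) b)⁻¹) ^ 2 else 0)
    (x : Site P i)
    (p : Fin 4 → ℝ) (hp : dotProduct p p = 1) :
    dotProduct p ((∑ b : PBond P i, if box b ∧ b.src = x then
          ![(((V b * h b.tgt * (W b)⁻¹ : Matrix.specialUnitaryGroup (Fin 2) ℂ) : Matrix (Fin 2) (Fin 2) ℂ) 0 0).re,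
            (((V b * h b.tgt * (W b)⁻¹ : Matrix.specialUnitaryGroup (Fin 2) ℂ) : Matrix (Fin 2) (Fin 2) ℂ) 0 0).im,
            (((V b * h b.tgt * (W b)⁻¹ : Matrix.specialUnitaryGroup (Fin 2) ℂ) : Matrix (Fin 2) (Fin 2) ℂ) 1 0).re,
            (((V b * h b.tgt * (W b)⁻¹ : Matrix.specialUnitaryGroup (Fin 2) ℂ) : Matrix (Fin 2) (Fin 2) ℂ) 1 0).im] else 0) +
        ∑ b : PBond P i, if box b ∧ b.tgt = x then
          ![((((V b)⁻¹ * h b.src * W b : Matrix.specialUnitaryGroup (Fin 2) ℂ) : Matrix (Fin 2) (Fin 2) ℂ) 0 0).re,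
            ((((V b)⁻¹ * h b.src * W b : Matrix.specialUnitaryGroup (Fin 2) ℂ) : Matrix (Fin 2) (Fin 2) ℂ) 0 0).im,
            ((((V b)⁻¹ * h b.src * W b : Matrix.specialUnitaryGroup (Fin 2) ℂ) : Matrix (Fin 2) (Fin 2) ℂ) 1 0).re,
            ((((V b)⁻¹ * h b.src * W b : Matrix.specialUnitaryGroup (Fin 2) ℂ) : Matrix (Fin 2) (Fin 2) ℂ) 1 0).im] else 0) ≤
    dotProduct ![(((h x : Matrix.specialUnitaryGroup (Fin 2) ℂ) : Matrix (Fin 2) (Fin 2) ℂ) 0 0).re,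
        (((h x : Matrix.specialUnitaryGroup (Fin 2) ℂ) : Matrix (Fin 2) (Fin 2) ℂ) 0 0).im,
        (((h x : Matrix.specialUnitaryGroup (Fin 2) ℂ) : Matrix (Fin 2) (Fin 2) ℂ) 1 0).re,
        (((h x : Matrix.specialUnitaryGroup (Fin 2) ℂ) : Matrix (Fin 2) (Fin 2) ℂ) 1 0).im]
      ((∑ b : PBond P i, if box b ∧ b.src = x then
          ![(((V b * h b.tgt * (W b)⁻¹ : Matrix.specialUnitaryGroup (Fin 2) ℂ) : Matrix (Fin 2) (Fin 2) ℂ) 0 0).re,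
            (((V b * h b.tgt * (W b)⁻¹ : Matrix.specialUnitaryGroup (Fin 2) ℂ) : Matrix (Fin 2) (Fin 2) ℂ) 0 0).im,
            (((V b * h b.tgt * (W b)⁻¹ : Matrix.specialUnitaryGroup (Fin 2) ℂ) : Matrix (Fin 2) (Fin 2) ℂ) 1 0).re,
            (((V b * h b.tgt * (W b)⁻¹ : Matrix.specialUnitaryGroup (Fin 2) ℂ) : Matrix (Fin 2) (Fin 2) ℂ) 1 0).im] else 0) +
        ∑ b : PBond P i, if box b ∧ b.tgt = x then
          ![((((V b)⁻¹ * h b.src * W b : Matrix.specialUnitaryGroup (Fin 2) ℂ) : Matrix (Fin 2) (Fin 2) ℂ) 0 0).re,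
            ((((V b)⁻¹ * h b.src * W b : Matrix.specialUnitaryGroup (Fin 2) ℂ) : Matrix (Fin 2) (Fin 2) ℂ) 0 0).im,
            ((((V b)⁻¹ * h b.src * W b : Matrix.specialUnitaryGroup (Fin 2) ℂ) : Matrix (Fin 2) (Fin 2) ℂ) 1 0).re,
            ((((V b)⁻¹ * h b.src * W b : Matrix.specialUnitaryGroup (Fin 2) ℂ) : Matrix (Fin 2) (Fin 2) ℂ) 1 0).im] else 0) := by
  obtain ⟨g, hg⟩ := exists_su2_coords_eq p hp
  rw [← hg]
  exact dot_twistedNbr_le_of_orbitMin box V W h hmin x g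

/-- ★★★ **THE TWISTED ONE-SITE EULER–LAGRANGE EQUATION**: at a box-ℓ²-orbit minimiser, for every site `x`,
`√(N_x·N_x) · v(h_x) = N_x` — the twisted neighbour sum points along the site value (the discrete harmonic-map equation (I1)
«`‖N x‖ • u x = N x`» of the regularity files, for the twisted lattice map `u = v ∘ h`; when no box bond touches `x`, `N_x = 0` and the
statement is trivial). [cite: Balaban1987RG1, (0.14) p.254; Giaquinta1984, Ch. VI] -/
theorem oneSite_euler_lagrange (box : PBond P i → Prop) [DecidablePred box]
    (V W : GaugeField P i (Matrix.specialUnitaryGroup (Fin 2) ℂ)) (h : GaugeTransf P i (Matrix.specialUnitaryGroup (Fin 2) ℂ))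
    (hmin : ∀ k : GaugeTransf P i (Matrix.specialUnitaryGroup (Fin 2) ℂ),
      (∑ b : PBond P i, if box b then dist1 (V b * (GaugeField.gaugeAct h W b)⁻¹) ^ 2 else 0) ≤
        ∑ b : PBond P i, if box b then dist1 (V b * (GaugeField.gaugeAct k (GaugeField.gaugeAct h W) b)⁻¹) ^ 2 else 0)
    (x : Site P i) :
    Real.sqrt (dotProduct ((∑ b : PBond P i, if box b ∧ b.src = x then
          ![(((V b * h b.tgt * (W b)⁻¹ : Matrix.specialUnitaryGroup (Fin 2) ℂ) : Matrix (Fin 2) (Fin 2) ℂ) 0 0).re,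
            (((V b * h b.tgt * (W b)⁻¹ : Matrix.specialUnitaryGroup (Fin 2) ℂ) : Matrix (Fin 2) (Fin 2) ℂ) 0 0).im,
            (((V b * h b.tgt * (W b)⁻¹ : Matrix.specialUnitaryGroup (Fin 2) ℂ) : Matrix (Fin 2) (Fin 2) ℂ) 1 0).re,
            (((V b * h b.tgt * (W b)⁻¹ : Matrix.specialUnitaryGroup (Fin 2) ℂ) : Matrix (Fin 2) (Fin 2) ℂ) 1 0).im] else 0) +
        ∑ b : PBond P i, if box b ∧ b.tgt = x then
          ![((((V b)⁻¹ * h b.src * W b : Matrix.specialUnitaryGroup (Fin 2) ℂ) : Matrix (Fin 2) (Fin 2) ℂ) 0 0).re,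
            ((((V b)⁻¹ * h b.src * W b : Matrix.specialUnitaryGroup (Fin 2) ℂ) : Matrix (Fin 2) (Fin 2) ℂ) 0 0).im,
            ((((V b)⁻¹ * h b.src * W b : Matrix.specialUnitaryGroup (Fin 2) ℂ) : Matrix (Fin 2) (Fin 2) ℂ) 1 0).re,
            ((((V b)⁻¹ * h b.src * W b : Matrix.specialUnitaryGroup (Fin 2) ℂ) : Matrix (Fin 2) (Fin 2) ℂ) 1 0).im] else 0) ((∑ b : PBond P i, if box b ∧ b.src = x then
          ![(((V b * h b.tgt * (W b)⁻¹ : Matrix.specialUnitaryGroup (Fin 2) ℂ) : Matrix (Fin 2) (Fin 2) ℂ) 0 0).re,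
            (((V b * h b.tgt * (W b)⁻¹ : Matrix.specialUnitaryGroup (Fin 2) ℂ) : Matrix (Fin 2) (Fin 2) ℂ) 0 0).im,
            (((V b * h b.tgt * (W b)⁻¹ : Matrix.specialUnitaryGroup (Fin 2) ℂ) : Matrix (Fin 2) (Fin 2) ℂ) 1 0).re,
            (((V b * h b.tgt * (W b)⁻¹ : Matrix.specialUnitaryGroup (Fin 2) ℂ) : Matrix (Fin 2) (Fin 2) ℂ) 1 0).im] else 0) +
        ∑ b : PBond P i, if box b ∧ b.tgt = x then
          ![((((V b)⁻¹ * h b.src * W b : Matrix.specialUnitaryGroup (Fin 2) ℂ) : Matrix (Fin 2) (Fin 2) ℂ) 0 0).re,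
            ((((V b)⁻¹ * h b.src * W b : Matrix.specialUnitaryGroup (Fin 2) ℂ) : Matrix (Fin 2) (Fin 2) ℂ) 0 0).im,
            ((((V b)⁻¹ * h b.src * W b : Matrix.specialUnitaryGroup (Fin 2) ℂ) : Matrix (Fin 2) (Fin 2) ℂ) 1 0).re,
            ((((V b)⁻¹ * h b.src * W b : Matrix.specialUnitaryGroup (Fin 2) ℂ) : Matrix (Fin 2) (Fin 2) ℂ) 1 0).im] else 0)) •
      ![(((h x : Matrix.specialUnitaryGroup (Fin 2) ℂ) : Matrix (Fin 2) (Fin 2) ℂ) 0 0).re,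
        (((h x : Matrix.specialUnitaryGroup (Fin 2) ℂ) : Matrix (Fin 2) (Fin 2) ℂ) 0 0).im,
        (((h x : Matrix.specialUnitaryGroup (Fin 2) ℂ) : Matrix (Fin 2) (Fin 2) ℂ) 1 0).re,
        (((h x : Matrix.specialUnitaryGroup (Fin 2) ℂ) : Matrix (Fin 2) (Fin 2) ℂ) 1 0).im] =
    ((∑ b : PBond P i, if box b ∧ b.src = x then
          ![(((V b * h b.tgt * (W b)⁻¹ : Matrix.specialUnitaryGroup (Fin 2) ℂ) : Matrix (Fin 2) (Fin 2) ℂ) 0 0).re,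
            (((V b * h b.tgt * (W b)⁻¹ : Matrix.specialUnitaryGroup (Fin 2) ℂ) : Matrix (Fin 2) (Fin 2) ℂ) 0 0).im,
            (((V b * h b.tgt * (W b)⁻¹ : Matrix.specialUnitaryGroup (Fin 2) ℂ) : Matrix (Fin 2) (Fin 2) ℂ) 1 0).re,
            (((V b * h b.tgt * (W b)⁻¹ : Matrix.specialUnitaryGroup (Fin 2) ℂ) : Matrix (Fin 2) (Fin 2) ℂ) 1 0).im] else 0) +
        ∑ b : PBond P i, if box b ∧ b.tgt = x then
          ![((((V b)⁻¹ * h b.src * W b : Matrix.specialUnitaryGroup (Fin 2) ℂ) : Matrix (Fin 2) (Fin 2) ℂ) 0 0).re,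
            ((((V b)⁻¹ * h b.src * W b : Matrix.specialUnitaryGroup (Fin 2) ℂ) : Matrix (Fin 2) (Fin 2) ℂ) 0 0).im,
            ((((V b)⁻¹ * h b.src * W b : Matrix.specialUnitaryGroup (Fin 2) ℂ) : Matrix (Fin 2) (Fin 2) ℂ) 1 0).re,
            ((((V b)⁻¹ * h b.src * W b : Matrix.specialUnitaryGroup (Fin 2) ℂ) : Matrix (Fin 2) (Fin 2) ℂ) 1 0).im] else 0) :=
  sqrt_dot_smul_eq_of_forall_dot_le _ _ (coords_dot_self (h x))
    (fun p hp => unit_dot_twistedNbr_le_of_orbitMin box V W h hmin x p hp)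

end EL

end Summit.QuantumFields.YangMills.Theorems.PoincareLipschitzOrbitMinOneSiteSphere

end
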